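import Summits.QuantumFields.YangMills.Theorems.LuscherReductionTwistedTraceScalingBOGaugeAvgRider
import Summits.QuantumFields.YangMills.Theorems.LuscherReductionTwistedTraceScalingFPWeightIntegrand
import HarnessLib

/-!
# (C1c'-δ) THE GAUGE AVERAGE OF A FAT-TUBE-SUPPORTED COLOUR-INVARIANT FUNCTION AT A TUBE POINT IS A FLAT INTEGRAL IN THE BASED GNOMONIC CHART, and the rider sandwich for general measures
# (lane A of S-BASE, crux `TwistedTraceScaling` stmt-QuantumFields-20203, C4-CORE, the (OD) pen, steps (2)–(3) of the (C1c') plan, `pub/ym-fleet/ym-luscher-20007-p1/COARSE-DESIGN.md` §28.4)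

`…FPWeightIntegrand.gaugeAvg_eq_integral_fpIntegrand` writes the Faddeev–Popov weight `N(U*) = gaugeAvg recordWeightRho (tubePt p)` as the flat integral `∫ piGnDensity(w)·fpIntegrand p w dw` over
the based gnomonic chart.  The SAME holds for every bounded measurable colour-invariant `φ` supported in a thin tube — in particular for the BO function of record
`boFun χ₀ Ω_G = recordChi · R` (`…BOGaugeAvgRider.boFun_frozenProfile_eq_recordChi_mul_rider`), whose chart integrand is `fpIntegrand p w · R(U*^{basedExt(gno∘w)})`:
* §1 ★★ `gaugeAvg_eq_integral_basedChart` — `gaugeAvg φ (tubePt p) = ∫ piGnDensityReal(w)·φ((tubePt p)^{basedExt(gno∘w)}) dw` for colour-invariant `φ` with `supp φ ⊆ nearOne ρ₂`, `tubePt p ∈ nearOne ρ₁`,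
  `3(L−1)(ρ₁+ρ₂) < 2` (`integral_gaugeMeasure_eq_based` + `integral_pi_haar_eq_vacuumChart`; other hemisphere patterns do not meet the tube, `…BasedNearOne`);
* §2 ★ `integral_mul_rider_sandwich_of_tail` — the rider sandwich of `…BOGaugeAvgRider` for an ARBITRARY measure, with the off-core smallness stated as `∫ 𝟙_{G₁ᶜ}·a ≤ τ`:
  `r₋·(∫a − τ) ≤ ∫ a·r ≤ r₊·∫a + R_max·τ`.
With `a = piGnDensity·fpIntegrand p` and `G₁ = {‖w‖ ≤ r_c}` the two remaining inputs of (C1c') step (2) are now CHART statements next to the landed (N2) envelopes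
(`…FPWeightLaplace.fpIntegrand_envelope_hyps`: off-core `fpIntegrand ≤ e^{−c²r_c²/(2s²)}`, support in `‖w‖ ≤ R₁`; `…SliceTaylorBased` for the rider `e^{−q(fB(gnoParam w, p))}` on the core).
HONEST FRAMING: measure-theoretic plumbing for a stub of a child of the CONDITIONAL route R2b1; (C1c') (2a)(2b)(3)(5), (C4), (C5), (B-ST) OPEN; C4-CORE OPEN; not infinite volume, not a gap, not Clay.
-/

set_option autoImplicit false

noncomputable section

open MeasureTheory Real
open scoped BigOperators
open Literature.MathematicalPhysics.QuantumFieldTheory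
open Literature.MathematicalPhysics.QuantumLattice

namespace Summit.QuantumFields.YangMills.Theorems.FemtoTransferGap.TwoLattice.ConstTube

open Summit.QuantumFields.YangMills.Theorems.FemtoTransferGap
open Summit.QuantumFields.YangMills.Theorems.FemtoTransferGap.TwoLattice.Avg
open Summit.QuantumFields.YangMills.Theorems.FemtoTransferGap.TwoLattice.Stiff (LinkSpace)
open Summit.QuantumFields.YangMills.Theorems.FemtoTransferGap.TwoLattice.GnChart
open Literature.MathematicalPhysics.QuantumFieldTheory.Balaban1983to89.T4CubeChartGnomonic (gnoPoint)

variable (L : ℕ) [NeZero L]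

/-! ## §1 The gauge average at a tube point in the based gnomonic chart -/

/-- ★★ **Chart formula for the gauge average of a thin-tube-supported colour-invariant function.**  For a bounded measurable `φ` with `φ(cUc⁻¹) = φ(U)`, supported in `nearOne ρ₂`, and a
tube point `tubePt p ∈ nearOne ρ₁` with `3(L−1)(ρ₁+ρ₂) < 2`:  `gaugeAvg φ (tubePt p) = ∫ piGnDensityReal(w)·φ((tubePt p)^{basedExt(gno∘w)}) dw`. [cite: SeilerLNP1982, §2] -/
theorem gaugeAvg_eq_integral_basedChart {φ : GaugeConfig 3 L SU2 → ℝ} (hφm : Measurable φ) {C : ℝ} (hC : ∀ U, |φ U| ≤ C)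
    (hφinv : ∀ (c : SU2) (U : GaugeConfig 3 L SU2), φ (gaugeTransform (fun _ : Site 3 L => c) U) = φ U)
    {ρ₂ : ℝ} (hsupp : ∀ U, φ U ≠ 0 → U ∈ nearOne L ρ₂) (p : balancedSubmodule L × (Fin 3 → Fin 3 → ℝ)) {ρ₁ : ℝ}
    (hU1 : tubePt L p ∈ nearOne L ρ₁) (hsmall : 3 * ((L : ℝ) - 1) * (ρ₁ + ρ₂) < 2) :
    gaugeAvg φ (tubePt L p) = ∫ w : NzSite L → Fin 3 → ℝ, piGnDensityReal (NzSite L) w * φ (gaugeTransform (basedExt L fun y => gnoPoint (w y)) (tubePt L p)) := by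
  classical
  set g : (NzSite L → SU2) → ℝ := fun h => φ (gaugeTransform (basedExt L h) (tubePt L p)) with hg
  have hgm : Measurable g := (measurable_comp_gaugeTransform_left hφm (tubePt L p)).comp (measurable_basedExt L)
  have hgb : ∃ C' : ℝ, ∀ h, |g h| ≤ C' := ⟨C, fun h => hC _⟩
  have hg0 : ∀ V : NzSite L → SU2, (∃ i, scalarPart (V i) ≤ 0) → g V = 0 := by
    rintro V ⟨i, hi⟩
    by_contra hne
    have hmem := hsupp _ hne
    have hF := frobNorm_basedExt_sub_one_le L hU1 hmem i.1
    rw [basedExt_of_ne L V i.2] at hF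
    exact absurd (scalarPart_pos_of_frobNorm_lt_two (lt_of_le_of_lt hF hsmall)) (not_lt.mpr hi)
  -- full average = based average (colour invariance), then the vacuum chart
  have h1 : gaugeAvg φ (tubePt L p) = ∫ h, g h ∂basedMeasure L := by
    unfold gaugeAvg
    refine integral_gaugeMeasure_eq_based L (F := fun g' => φ (gaugeTransform g' (tubePt L p))) (measurable_comp_gaugeTransform_left hφm (tubePt L p)) (C := C)
      (fun g' => hC _) (fun c g' => ?_)
    have h : gaugeTransform (fun x => c * g' x) (tubePt L p) = gaugeTransform (fun _ => c) (gaugeTransform g' (tubePt L p)) := by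
      funext e; simp [gaugeTransform, mul_assoc]
    rw [h, hφinv]
  rw [h1, show basedMeasure L = Measure.pi (fun _ : NzSite L => haarProbability SU2) from rfl, integral_pi_haar_eq_vacuumChart (NzSite L) hgm hgb hg0]
  refine integral_congr_ae (ae_of_all _ fun w => ?_)
  have hchart : piPatternChart (NzSite L) (fun _ => false) w = fun y => gnoPoint (w y) := funext (piPatternChart_false (NzSite L) w)
  show piGnDensityReal (NzSite L) w * g (piPatternChart (NzSite L) (fun _ => false) w) = _
  rw [hchart]

variable {L}

/-! ## §2 The rider sandwich for an arbitrary measure -/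

/-- ★ **Rider sandwich, tail form.**  For any measure: `0 ≤ a`, `0 ≤ r ≤ R_max`, `r ∈ [r₋, r₊]` on a measurable `G₁` (`0 ≤ r₋, r₊`), `∫ 𝟙_{G₁ᶜ}·a ≤ τ`, with `a` and `a·r` integrable ⇒
`r₋·(∫a − τ) ≤ ∫ a·r ≤ r₊·∫a + R_max·τ`. [folklore] -/
theorem integral_mul_rider_sandwich_of_tail {α : Type*} [MeasurableSpace α] {μ : Measure α} {a r : α → ℝ} (ha0 : ∀ x, 0 ≤ a x) {Rmax : ℝ} (hRmax : 0 ≤ Rmax)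
    (hr0 : ∀ x, 0 ≤ r x) (hrmax : ∀ x, r x ≤ Rmax) {G₁ : Set α} (hG₁ : MeasurableSet G₁) {rlo rhi τ : ℝ} (hrlo : 0 ≤ rlo) (hrhi : 0 ≤ rhi)
    (hG : ∀ x ∈ G₁, rlo ≤ r x ∧ r x ≤ rhi) (htail : ∫ x, G₁ᶜ.indicator a x ∂μ ≤ τ) (hai : Integrable a μ) (hari : Integrable (fun x => a x * r x) μ) :
    rlo * (∫ x, a x ∂μ - τ) ≤ ∫ x, a x * r x ∂μ ∧ ∫ x, a x * r x ∂μ ≤ rhi * ∫ x, a x ∂μ + Rmax * τ := by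
  have htaili : Integrable (fun x => G₁ᶜ.indicator a x) μ := hai.indicator hG₁.compl
  -- pointwise comparisons
  have hup : ∀ x, a x * r x ≤ rhi * a x + Rmax * G₁ᶜ.indicator a x := fun x => by
    by_cases hx : x ∈ G₁
    · rw [Set.indicator_of_notMem (Set.notMem_compl_iff.2 hx), mul_zero, add_zero, mul_comm]
      exact mul_le_mul_of_nonneg_right (hG x hx).2 (ha0 x)
    · rw [Set.indicator_of_mem (Set.mem_compl hx)]
      have h1 : a x * r x ≤ a x * Rmax := mul_le_mul_of_nonneg_left (hrmax x) (ha0 x)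
      have h2 : 0 ≤ rhi * a x := mul_nonneg hrhi (ha0 x)
      linarith [mul_comm (a x) Rmax]
  have hlow : ∀ x, rlo * a x - rlo * G₁ᶜ.indicator a x ≤ a x * r x := fun x => by
    by_cases hx : x ∈ G₁
    · rw [Set.indicator_of_notMem (Set.notMem_compl_iff.2 hx), mul_zero, sub_zero, mul_comm]
      exact mul_le_mul_of_nonneg_left (hG x hx).1 (ha0 x)
    · rw [Set.indicator_of_mem (Set.mem_compl hx), sub_self]; exact mul_nonneg (ha0 x) (hr0 x)
  constructor
  · have hint1 : Integrable (fun x => rlo * a x - rlo * G₁ᶜ.indicator a x) μ := (hai.const_mul rlo).sub (htaili.const_mul rlo)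
    have h := integral_mono hint1 hari hlow
    have hI : ∫ x, (rlo * a x - rlo * G₁ᶜ.indicator a x) ∂μ = rlo * ∫ x, a x ∂μ - rlo * ∫ x, G₁ᶜ.indicator a x ∂μ := by
      rw [integral_sub (hai.const_mul rlo) (htaili.const_mul rlo), integral_const_mul, integral_const_mul]
    rw [hI] at h
    nlinarith [mul_le_mul_of_nonneg_left htail hrlo]
  · have hint2 : Integrable (fun x => rhi * a x + Rmax * G₁ᶜ.indicator a x) μ := (hai.const_mul rhi).add (htaili.const_mul Rmax)
    have h := integral_mono hari hint2 hup
    have hI : ∫ x, (rhi * a x + Rmax * G₁ᶜ.indicator a x) ∂μ = rhi * ∫ x, a x ∂μ + Rmax * ∫ x, G₁ᶜ.indicator a x ∂μ := by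
      rw [integral_add (hai.const_mul rhi) (htaili.const_mul Rmax), integral_const_mul, integral_const_mul]
    rw [hI] at h
    nlinarith [mul_le_mul_of_nonneg_left htail hRmax]

end Summit.QuantumFields.YangMills.Theorems.FemtoTransferGap.TwoLattice.ConstTube

end
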